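import Mathlib.Analysis.Analytic.Uniqueness
import Mathlib.Analysis.Analytic.OfScalars
import Summits.QuantumFields.BalabanUV.Beta.EriceFlowEnclosureBorelSum
import Summits.QuantumFields.BalabanUV.Beta.EriceFlowEnclosureBorelCroissant

/-!
# Beta / EriceFlowEnclosureBorelCorrespondence — THE BOREL–LAPLACE CORRESPONDENCE CLOSES UP: a function with uniform Gevrey-1
# asymptotics on a sector of opening > π IS THE BOREL SUM OF ITS LETTERS IN EVERY DIRECTION of the Borel sector, ON A WHOLE WIDE
# SECTOR near `0` (34g gave the real direction on the Borel disc only) — 34g `borel_summable` (f ↦ B) composed with 35c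
# `laplace_sectorial` (B ↦ f̃) and the identity theorem on the star-shaped sector (f = f̃); and the letters of the Borel transform
# are its Taylor coefficients (B ↦ f̃ ↦ B by 34g `borelTransform_unique`)
# (β-flow team, prover 3, unit `b2b-balaban-beta-bflow-p3`, gen 39; bflow-p3 MODULE 35d over 34g ∕ 35c; Mathlib + tree only)

HONEST FRAMING (page 1 of everything the β sub-cell writes): discharging `BetaPertH` makes Bałaban's UV stability UNCONDITIONAL — a
real constructive-QFT result; it is NOT the continuum limit and NOT the Clay problem.  HONEST DEPENDENCY (cell reorg 2026-08-19,
verbatim): «continuum YM on T⁴ ⇐ BetaPertH ∧ nine spine estimates (0/9 proved); BetaPertH ⇐ (D1) ∧ (D4) ∧ CAP+tail; G-an2-4 gates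
asym, D1 and NE2/3/4.»  THIS MODULE DISCHARGES NOTHING: [folklore] one-variable complex analysis over Mathlib and the tree's MODULE
32∕34∕35 service files (no β-function, no flow, no Erice sentence is used).

SOURCE (shapes only).  [LodayRichaud2016] Prop 5.3.12 p. 165 (Borel–Laplace summability in a direction is equivalent to
1-summability in that direction — our summary, both implications), Thm 5.3.9 pp. 156–163; [MitschiSauzin2016] Chap. 5 §5.9 Def 5.33 and Lemma 5.35 (gluing of the
`𝓛^θ`; a convergent series is 1-summable in all directions and `𝒮^I φ̃₀` coincides with its sum); [Rivasseau1991] Thm I.5.1 and its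
«reciprocal» pp. 55–56.  Ours: sectors `S(r,σ) = {‖z‖ < r, Re z > −σ‖z‖}` (`0 < σ ≤ 1` for the identity theorem, 32a
`isPreconnected_sector`), slopes `|m| < σ∕2`, three explicit constants.

THE POINT.  (§1) Two functions holomorphic on `S(r,σ)` which agree on its Borel lens `{Re z⁻¹ > c}` agree on `S(r,σ)` (identity
theorem; the sector is star-shaped about `r∕2`, the lens contains the small positive reals).  (§2) `f ↦ B` (34g) `↦ f̃` (35c, with
`R = 1∕(2K)`, `M` = a bound of `B` on the closed half-disc by compactness, `κ = σ∕2`, `m₀ = min(σ∕4, 1∕2)`, growth constants made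
non-negative): `f` and `f̃` share the real-direction Laplace representation on `Re z⁻¹ > max(1∕r, c)`, so `f = f̃` on the common
sector, and 35c's directional representations of `f̃` are representations of `f`.  (§3) Taylor (Mathlib
`Complex.hasSum_taylorSeries_on_ball`): the Borel transform produced by 34g from 35c's `f̃` sums `Σ B⁽ⁿ⁾(0)τⁿ∕n!`, as does `B`, so
34g `borelTransform_unique` identifies them.

WHAT THIS FILE PROVES (0 sorry, 0 def).  §1 **`eqOn_sector_of_eqOn_borelLens`**.  §2 `im_inv_nonpos_iff`, HEADLINE
**`borel_sum_allDirections`**: `0 < r`, `0 < σ ≤ 1`, `0 < K`, `f` holomorphic on `S(r,σ)` with `‖f z − Σ_{n<N} a_n zⁿ‖ ≤ C·K^N·N!·‖z‖^N`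
⟹ **∃ B c m₀, `0 ≤ c`, `0 < m₀ < σ∕2`, `B` holomorphic on `ball 0 K⁻¹ ∪ T_{σ∕2}` with `HasSum (a_n τⁿ∕n!) (B τ)` on the disc, and for
EVERY slope `|m| < σ∕2` and every `z ∈ S(r,σ)` with `‖z‖ < m₀∕(16c + m₀)`, `Re z > −(m₀∕4)‖z‖` and `Re(z⁻¹d_m) > c‖d_m‖`:
`t ↦ e^{−t·d_m∕z}B(td_m)` is integrable on `(0,∞)` and `f z = z⁻¹·d_m∫₀^∞ e^{−t·d_m∕z}B(td_m)dt`; the slopes `+m₀` (resp. `−m₀`)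
serve every such `z` with `Im z ≥ 0` (resp. `≤ 0`)** — f is the Borel sum of its letters in all directions, on a whole wide sector.
§3 `hasSum_taylor_letters`, **`letters_unique`** ∕ `letters_eq_iteratedDeriv` (the letters of a Borel function are its Taylor
coefficients — 35c's Gevrey clause reads in 34g's letters), **`borelTransform_eq_of_taylor`** (B ↦ f̃ ↦ B).
NOT CLAIMED: optimal constants ∕ openings, Nevanlinna's strip form, resurgence; anything about Erice's β; `BetaPertH`, continuum, Clay.
-/

namespace Summit.QuantumFields.BalabanUV.Beta.EriceFlowEnclosureBorelCorrespondence

open Set Filter Topology MeasureTheory Metric Complex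
open scoped Real Nat
open Summit.QuantumFields.BalabanUV.Beta.EriceFlowEnclosureGevreyWatson (isOpen_sector ofReal_mem_sector isPreconnected_sector)
open Summit.QuantumFields.BalabanUV.Beta.EriceFlowEnclosureBorelSum (borel_summable borelTransform_unique)
open Summit.QuantumFields.BalabanUV.Beta.EriceFlowEnclosureBorelDirectional
open Summit.QuantumFields.BalabanUV.Beta.EriceFlowEnclosureBorelDirectionalCauchy
open Summit.QuantumFields.BalabanUV.Beta.EriceFlowEnclosureBorelCroissant

noncomputable section

/-! ## §1 The Borel lens determines a sectorial function -/

/-- **Two functions holomorphic on the sector `S(r,σ)` (`0 < σ ≤ 1`) which agree on its Borel lens `{Re z⁻¹ > c}` (`c ≥ 0`) agree on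
the whole sector** (identity theorem on the star-shaped, hence preconnected, sector; the lens contains the reals `0 < t < min(r, 1∕c)`
and is a neighbourhood of each of them). [folklore] -/
theorem eqOn_sector_of_eqOn_borelLens {f g : ℂ → ℂ} {r σ c : ℝ} (hr : 0 < r) (hσ : 0 < σ) (hσ1 : σ ≤ 1) (hc : 0 ≤ c)
    (hf : DifferentiableOn ℂ f {z : ℂ | ‖z‖ < r ∧ -σ * ‖z‖ < z.re})
    (hg : DifferentiableOn ℂ g {z : ℂ | ‖z‖ < r ∧ -σ * ‖z‖ < z.re})
    (hfg : ∀ z ∈ {z : ℂ | ‖z‖ < r ∧ -σ * ‖z‖ < z.re}, c < (z⁻¹).re → f z = g z) :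
    EqOn f g {z : ℂ | ‖z‖ < r ∧ -σ * ‖z‖ < z.re} := by
  set S : Set ℂ := {z : ℂ | ‖z‖ < r ∧ -σ * ‖z‖ < z.re} with hS
  have hSo : IsOpen S := isOpen_sector r σ
  -- the base point `t₀ = min(r∕2, 1∕(c+1))`
  set t₀ : ℝ := min (r / 2) (1 / (c + 1)) with ht₀
  have ht₀pos : 0 < t₀ := lt_min (by positivity) (by positivity)
  have ht₀r : t₀ < r := (min_le_left _ _).trans_lt (by linarith)
  have ht₀S : ((t₀ : ℂ)) ∈ S := ofReal_mem_sector hσ ht₀pos ht₀r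
  have ht₀c : c < (((t₀ : ℂ))⁻¹).re := by
    rw [← Complex.ofReal_inv, Complex.ofReal_re]
    have h1 : t₀ ≤ 1 / (c + 1) := min_le_right _ _
    have h2 : c + 1 ≤ t₀⁻¹ := by
      rw [le_inv_comm₀ (by positivity) ht₀pos]; rwa [one_div] at h1
    linarith
  have ht₀0 : ((t₀ : ℂ)) ≠ 0 := by exact_mod_cast ht₀pos.ne'
  -- the lens is a neighbourhood of `t₀`
  have hlens : {z : ℂ | c < (z⁻¹).re} ∈ 𝓝 ((t₀ : ℂ)) :=
    (continuousAt_inv₀ ht₀0).preimage_mem_nhds ((isOpen_lt continuous_const Complex.continuous_re).mem_nhds ht₀c)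
  have hev : f =ᶠ[𝓝 ((t₀ : ℂ))] g := by
    filter_upwards [hlens, hSo.mem_nhds ht₀S] with z hz hzS using hfg z hzS hz
  exact (hf.analyticOnNhd hSo).eqOn_of_preconnected_of_eventuallyEq (hg.analyticOnNhd hSo)
    (isPreconnected_sector hr hσ hσ1) ht₀S hev

/-! ## §2 A sectorial function is the Borel sum of its letters in every direction, on a whole wide sector -/

/-- `Im z⁻¹ ≤ 0 ↔ 0 ≤ Im z` and `0 ≤ Im z⁻¹ ↔ Im z ≤ 0` (`Im z⁻¹ = −Im z∕‖z‖²`). [folklore] -/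
theorem im_inv_nonpos_iff {z : ℂ} (hz : z ≠ 0) : ((z⁻¹).im ≤ 0 ↔ 0 ≤ z.im) ∧ (0 ≤ (z⁻¹).im ↔ z.im ≤ 0) := by
  have hn : 0 < Complex.normSq z := Complex.normSq_pos.mpr hz
  rw [Complex.inv_im]
  constructor
  · rw [div_nonpos_iff]; constructor
    · rintro (⟨h1, h2⟩ | ⟨h1, h2⟩) <;> linarith
    · intro h; exact Or.inr ⟨by linarith, hn.le⟩
  · rw [div_nonneg_iff]; constructor
    · rintro (⟨h1, h2⟩ | ⟨h1, h2⟩) <;> linarith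
    · intro h; exact Or.inl ⟨by linarith, hn.le⟩

/-- **A FUNCTION WITH UNIFORM GEVREY-1 ASYMPTOTICS ON A SECTOR OF OPENING > π IS THE BOREL SUM OF ITS LETTERS IN EVERY DIRECTION OF
THE BOREL SECTOR, ON A WHOLE WIDE SECTOR NEAR `0`.**  Let `0 < σ ≤ 1`, `0 < K`, `f` holomorphic on `S(r,σ) = {‖z‖ < r, Re z > −σ‖z‖}`
with `‖f z − Σ_{n<N} a_n zⁿ‖ ≤ C·K^N·N!·‖z‖^N` for all `N`, `z`.  Then there are the Borel transform `B` — holomorphic on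
`ball 0 K⁻¹ ∪ {Re τ > 0, |Im τ| < (σ∕2)Re τ}` and summing the Borel series `Σ a_n τⁿ∕n!` on the disc (34g) — and constants `c ≥ 0`,
`0 < m₀ < σ∕2` such that for EVERY slope `|m| < σ∕2` (`d_m = 1 + m·i`) and every `z ∈ S(r,σ)` with `‖z‖ < m₀∕(16c + m₀)`,
`Re z > −(m₀∕4)‖z‖` and `Re(z⁻¹d_m) > c‖d_m‖`: `t ↦ e^{−t·d_m∕z}B(td_m)` is integrable on `(0,∞)` and
`f z = z⁻¹·d_m·∫₀^∞ e^{−t·d_m∕z}B(td_m)dt`; moreover the slope `+m₀` (resp. `−m₀`) satisfies the convergence condition at every such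
`z` with `Im z ≥ 0` (resp. `Im z ≤ 0`) — so the two tilted Borel sums cover the whole wide sector
`S(min(r, m₀∕(16c+m₀)), min(σ, m₀∕4))`. [cite: LodayRichaud2016, Prop 5.3.12 and Thm 5.3.9] [cite: MitschiSauzin2016, §5.9 Def 5.33] -/
theorem borel_sum_allDirections {f : ℂ → ℂ} {a : ℕ → ℂ} {r σ C K : ℝ} (hr : 0 < r) (hσ : 0 < σ) (hσ1 : σ ≤ 1) (hK : 0 < K)
    (hf : DifferentiableOn ℂ f {z : ℂ | ‖z‖ < r ∧ -σ * ‖z‖ < z.re})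
    (hgev : ∀ N : ℕ, ∀ z ∈ {z : ℂ | ‖z‖ < r ∧ -σ * ‖z‖ < z.re},
      ‖f z - ∑ n ∈ Finset.range N, a n * z ^ n‖ ≤ C * K ^ N * N ! * ‖z‖ ^ N) :
    ∃ B : ℂ → ℂ, ∃ c m₀ : ℝ, 0 ≤ c ∧ 0 < m₀ ∧ m₀ < σ / 2 ∧
      DifferentiableOn ℂ B (ball 0 K⁻¹ ∪ {τ : ℂ | 0 < τ.re ∧ |τ.im| < σ / 2 * τ.re}) ∧
      (∀ τ : ℂ, ‖τ‖ < K⁻¹ → HasSum (fun n : ℕ => a n * (τ ^ n / (n ! : ℂ))) (B τ)) ∧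
      (∀ m : ℝ, |m| < σ / 2 → ∀ z ∈ {z : ℂ | ‖z‖ < r ∧ -σ * ‖z‖ < z.re},
        ‖z‖ < m₀ / (16 * c + m₀) → -(m₀ / 4) * ‖z‖ < z.re →
        c * ‖(1 : ℂ) + (m : ℂ) * I‖ < (z⁻¹ * ((1 : ℂ) + (m : ℂ) * I)).re →
        IntegrableOn (fun t : ℝ => cexp (-(t : ℂ) * (z⁻¹ * ((1 : ℂ) + (m : ℂ) * I))) * B ((t : ℂ) * ((1 : ℂ) + (m : ℂ) * I)))
          (Ioi 0) ∧
        f z = z⁻¹ * (((1 : ℂ) + (m : ℂ) * I) *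
          ∫ t in Ioi (0 : ℝ), cexp (-(t : ℂ) * (z⁻¹ * ((1 : ℂ) + (m : ℂ) * I))) * B ((t : ℂ) * ((1 : ℂ) + (m : ℂ) * I)))) ∧
      (∀ z ∈ {z : ℂ | ‖z‖ < r ∧ -σ * ‖z‖ < z.re}, ‖z‖ < m₀ / (16 * c + m₀) → -(m₀ / 4) * ‖z‖ < z.re →
        (0 ≤ z.im → c * ‖(1 : ℂ) + (m₀ : ℂ) * I‖ < (z⁻¹ * ((1 : ℂ) + (m₀ : ℂ) * I)).re) ∧
        (z.im ≤ 0 → c * ‖(1 : ℂ) + ((-m₀ : ℝ) : ℂ) * I‖ < (z⁻¹ * ((1 : ℂ) + ((-m₀ : ℝ) : ℂ) * I)).re)) := by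
  set S : Set ℂ := {z : ℂ | ‖z‖ < r ∧ -σ * ‖z‖ < z.re} with hS
  set T : Set ℂ := {τ : ℂ | 0 < τ.re ∧ |τ.im| < σ / 2 * τ.re} with hT
  -- ### 34g: the Borel transform
  obtain ⟨B, hBd, hBs, -, ⟨A, L, hBg⟩, hBi⟩ := borel_summable hr hσ hK hf hgev
  -- a bound on the half-disc (compactness)
  have hKi : 0 < K⁻¹ := inv_pos.mpr hK
  set R : ℝ := K⁻¹ / 2 with hR
  have hRpos : 0 < R := by positivity
  have hRK : R < K⁻¹ := by rw [hR]; linarith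
  obtain ⟨M, hM⟩ := (isCompact_closedBall (0 : ℂ) R).exists_bound_of_continuousOn
    (hBd.continuousOn.mono fun τ hτ => Or.inl (closedBall_subset_ball hRK hτ))
  have hBM : ∀ τ ∈ ball (0 : ℂ) R, ‖B τ‖ ≤ M := fun τ hτ => hM τ (ball_subset_closedBall hτ)
  -- non-negative growth constants
  set c : ℝ := max L 0 with hc
  set A' : ℝ := max A 0 with hA'
  have hc0 : 0 ≤ c := le_max_right _ _
  have hA'0 : 0 ≤ A' := le_max_right _ _
  have hBg' : ∀ τ ∈ T, ‖B τ‖ ≤ A' * Real.exp (c * ‖τ‖) := by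
    intro τ hτ
    refine (hBg τ hτ).trans ?_
    have h1 : Real.exp (L * ‖τ‖) ≤ Real.exp (c * ‖τ‖) :=
      Real.exp_le_exp.mpr (mul_le_mul_of_nonneg_right (le_max_left _ _) (norm_nonneg _))
    calc A * Real.exp (L * ‖τ‖) ≤ A' * Real.exp (L * ‖τ‖) := mul_le_mul_of_nonneg_right (le_max_left _ _) (Real.exp_pos _).le
      _ ≤ A' * Real.exp (c * ‖τ‖) := mul_le_mul_of_nonneg_left h1 hA'0
  -- ### 35c: the glued directional Laplace transforms
  set m₀ : ℝ := min (σ / 4) (1 / 2) with hm₀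
  have hm₀pos : 0 < m₀ := lt_min (by positivity) (by norm_num)
  have hm₀κ : m₀ < σ / 2 := (min_le_left _ _).trans_lt (by linarith)
  have hm₀1 : m₀ ≤ 1 / 2 := min_le_right _ _
  have hBdR : DifferentiableOn ℂ B (ball (0 : ℂ) R ∪ T) :=
    hBd.mono (union_subset_union_left _ (ball_subset_ball hRK.le))
  obtain ⟨g, hgd, -, hglap, hgdir⟩ := laplace_sectorial hRpos hc0 hA'0 hm₀pos hm₀κ hm₀1 hBdR hBM hBg'
  set r₁ : ℝ := m₀ / (16 * c + m₀) with hr₁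
  set S₁ : Set ℂ := {z : ℂ | ‖z‖ < r₁ ∧ -(m₀ / 4) * ‖z‖ < z.re} with hS₁
  have hr₁pos : 0 < r₁ := by rw [hr₁]; positivity
  -- ### `f = g` on the common sector `S₂ = S(min r r₁, min σ (m₀∕4))`
  set r₂ : ℝ := min r r₁ with hr₂
  set σ₂ : ℝ := min σ (m₀ / 4) with hσ₂
  set S₂ : Set ℂ := {z : ℂ | ‖z‖ < r₂ ∧ -σ₂ * ‖z‖ < z.re} with hS₂
  have hr₂pos : 0 < r₂ := lt_min hr hr₁pos
  have hσ₂pos : 0 < σ₂ := lt_min hσ (by positivity)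
  have hσ₂1 : σ₂ ≤ 1 := (min_le_left _ _).trans hσ1
  have hS₂S : S₂ ⊆ S := fun z hz =>
    ⟨hz.1.trans_le (min_le_left _ _), by nlinarith [hz.2, min_le_left σ (m₀ / 4), norm_nonneg z]⟩
  have hS₂S₁ : S₂ ⊆ S₁ := fun z hz =>
    ⟨hz.1.trans_le (min_le_right _ _), by nlinarith [hz.2, min_le_right σ (m₀ / 4), norm_nonneg z]⟩
  have hmemS₂ : ∀ z ∈ S, ‖z‖ < r₁ → -(m₀ / 4) * ‖z‖ < z.re → z ∈ S₂ := by
    intro z hz h1 h2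
    refine ⟨lt_min hz.1 h1, ?_⟩
    rcases le_total σ (m₀ / 4) with h | h
    · rw [hσ₂, min_eq_left h]; exact hz.2
    · rw [hσ₂, min_eq_right h]; exact h2
  have hfg : EqOn f g S₂ := by
    refine eqOn_sector_of_eqOn_borelLens hr₂pos hσ₂pos hσ₂1 (c := max (1 / r) c) (by positivity) (hf.mono hS₂S)
      (hgd.mono fun z hz => Or.inl (hS₂S₁ hz)) fun z _ hz => ?_
    have h1 : 1 / r < (z⁻¹).re := (le_max_left _ _).trans_lt hz
    have h2 : c < (z⁻¹).re := (le_max_right _ _).trans_lt hz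
    rw [(hBi z h1).2, (hglap z h2).2]
  -- ### ray data for every slope
  have hTD : T ⊆ ball (0 : ℂ) R ∪ T := subset_union_right
  refine ⟨B, c, m₀, hc0, hm₀pos, hm₀κ, hBd, hBs, fun m hm z hz h1 h2 hconv => ?_, fun z hz h1 h2 => ?_⟩
  · have hz₂ : z ∈ S₂ := hmemS₂ z hz h1 h2
    refine ⟨integrableOn_laplace_directional (continuousOn_ray hBdR hTD hm) (growth_ray hBg' hm) z⁻¹ hconv, ?_⟩
    rw [hfg hz₂]
    exact hgdir m hm z (Or.inl (hS₂S₁ hz₂)) hconv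
  · -- the covering: `+m₀` serves `Im z ≥ 0`, `−m₀` serves `Im z ≤ 0`
    have hz₁ : z ∈ S₁ := hS₂S₁ (hmemS₂ z hz h1 h2)
    have hρ : 1 / (m₀ / (16 * c + m₀)) = 16 * c / m₀ + 1 := by field_simp
    have hw : 16 * c / m₀ + 1 < ‖z⁻¹‖ ∧ -(m₀ / 4) * ‖z⁻¹‖ < (z⁻¹).re := by
      have h := inv_mem_Omega hz₁; rw [hρ] at h; exact h
    have hz0 : z ≠ 0 := by rintro rfl; simp [hS₁] at hz₁
    obtain ⟨hi1, hi2⟩ := im_inv_nonpos_iff hz0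
    refine ⟨fun him => ?_, fun him => ?_⟩
    · have h := (cover hm₀pos hm₀1 hc0 (Or.inl rfl) hw (ε := 1) (by rw [one_mul]; exact hi1.mpr him)).1
      rwa [one_mul] at h
    · have h := (cover hm₀pos hm₀1 hc0 (Or.inr rfl) hw (ε := -1) (by linarith [hi2.mpr him])).1
      rwa [neg_one_mul] at h

/-! ## §3 The letters of a Borel transform are its Taylor coefficients (B ↦ f̃ ↦ B) -/

/-- **Taylor**: `B` holomorphic on `‖τ‖ < R` sums `Σ B⁽ⁿ⁾(0)·τⁿ∕n!` there (Mathlib `Complex.hasSum_taylorSeries_on_ball`). [folklore] -/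
theorem hasSum_taylor_letters {B : ℂ → ℂ} {R : ℝ} (hBd : DifferentiableOn ℂ B (ball 0 R)) {τ : ℂ} (hτ : ‖τ‖ < R) :
    HasSum (fun n : ℕ => iteratedDeriv n B 0 * (τ ^ n / (n ! : ℂ))) (B τ) := by
  have e : (fun n : ℕ => iteratedDeriv n B 0 * (τ ^ n / (n ! : ℂ))) =
      fun n : ℕ => (n ! : ℂ)⁻¹ • (τ - 0) ^ n • iteratedDeriv n B 0 := by
    funext n; simp only [sub_zero, smul_eq_mul]; ring
  rw [e]; exact Complex.hasSum_taylorSeries_on_ball hBd (mem_ball_zero_iff.mpr hτ)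

/-- **Uniqueness of Borel letters.**  If two Borel series `Σ a_n τⁿ∕n!` and `Σ a′_n τⁿ∕n!` sum to the same function on a disc
`‖τ‖ < ρ`, then `a = a′` (uniqueness of one-variable power series: Mathlib `HasFPowerSeriesAt.eq_formalMultilinearSeries` for the
scalar series `ofScalars (a_n∕n!)`, whose radius is `≥ ρ∕2` because the terms at `τ = ρ∕2` tend to `0`). [folklore] -/
theorem letters_unique {B : ℂ → ℂ} {a a' : ℕ → ℂ} {ρ : ℝ} (hρ : 0 < ρ)
    (ha : ∀ τ : ℂ, ‖τ‖ < ρ → HasSum (fun n : ℕ => a n * (τ ^ n / (n ! : ℂ))) (B τ))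
    (ha' : ∀ τ : ℂ, ‖τ‖ < ρ → HasSum (fun n : ℕ => a' n * (τ ^ n / (n ! : ℂ))) (B τ)) : a = a' := by
  have key : ∀ c : ℕ → ℂ, (∀ τ : ℂ, ‖τ‖ < ρ → HasSum (fun n : ℕ => c n * (τ ^ n / (n ! : ℂ))) (B τ)) →
      HasFPowerSeriesAt B (FormalMultilinearSeries.ofScalars ℂ (fun n : ℕ => c n / (n ! : ℂ))) 0 := by
    intro c hc
    set r : NNReal := ⟨ρ / 2, by positivity⟩ with hr
    have hrρ : ((r : ℝ)) = ρ / 2 := rfl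
    refine ⟨r, ?_, ?_, fun {y} hy => ?_⟩
    · -- `r ≤ radius`: the terms at `τ = ρ∕2` tend to `0`
      refine FormalMultilinearSeries.le_radius_of_tendsto _ (l := 0) ?_
      have hs := (hc ((ρ / 2 : ℝ) : ℂ) (by
        rw [Complex.norm_real, Real.norm_of_nonneg (by positivity)]; linarith)).summable.tendsto_atTop_zero.norm
      rw [norm_zero] at hs
      refine hs.congr fun n => ?_
      rw [FormalMultilinearSeries.ofScalars_norm, hrρ, norm_mul, norm_div, norm_div, Complex.norm_pow, Complex.norm_real,
        Real.norm_of_nonneg (by positivity : (0 : ℝ) ≤ ρ / 2)]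
      ring
    · exact_mod_cast (by positivity : (0 : ℝ) < ρ / 2)
    · have hy' : ‖y‖ < ρ := by
        rw [Metric.eball_coe, mem_ball_zero_iff] at hy
        have : ‖y‖ < ρ / 2 := hy
        linarith
      have e : (fun n : ℕ => (FormalMultilinearSeries.ofScalars ℂ (fun n : ℕ => c n / (n ! : ℂ)) n) fun _ : Fin n => y) =
          fun n : ℕ => c n * (y ^ n / (n ! : ℂ)) := by
        funext n; rw [FormalMultilinearSeries.ofScalars_apply_eq, smul_eq_mul]; ring
      rw [e, zero_add]
      exact hc y hy'
  have h := (key a ha).eq_formalMultilinearSeries (key a' ha')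
  funext n
  have hn := congrArg (fun p : FormalMultilinearSeries ℂ ℂ ℂ => (p n) fun _ : Fin n => (1 : ℂ)) h
  simp only [FormalMultilinearSeries.ofScalars_apply_eq, one_pow, smul_eq_mul, mul_one] at hn
  have hf : (n ! : ℂ) ≠ 0 := by exact_mod_cast Nat.factorial_ne_zero n
  field_simp at hn
  exact hn

/-- **The letters of a Borel function are its Taylor coefficients**: `HasSum (a_n τⁿ∕n!) (B τ)` on `‖τ‖ < ρ` with `B` holomorphic there
⟹ `a_n = B⁽ⁿ⁾(0)` — so 35c's Gevrey clause (letters `B⁽ⁿ⁾(0)`) reads in 34g's letters. [folklore] -/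
theorem letters_eq_iteratedDeriv {B : ℂ → ℂ} {a : ℕ → ℂ} {ρ : ℝ} (hρ : 0 < ρ) (hBd : DifferentiableOn ℂ B (ball 0 ρ))
    (ha : ∀ τ : ℂ, ‖τ‖ < ρ → HasSum (fun n : ℕ => a n * (τ ^ n / (n ! : ℂ))) (B τ)) (n : ℕ) :
    a n = iteratedDeriv n B 0 :=
  congrFun (letters_unique hρ ha fun _ hτ => hasSum_taylor_letters hBd hτ) n

/-- **B ↦ f̃ ↦ B.**  If `B` is holomorphic on `ball 0 R ∪ T_κ` and `B′` — e.g. the Borel transform that 34g `borel_summable` attaches to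
35c's glued Laplace sum `f̃` of `B`, whose letters are `B⁽ⁿ⁾(0)` — is holomorphic on `ball 0 K⁻¹ ∪ T_{σ∕2}` and sums `Σ B⁽ⁿ⁾(0)τⁿ∕n!`
on `‖τ‖ < K⁻¹`, then `B′ = B` on `ball 0 (min R K⁻¹) ∪ T_{min κ (σ∕2)}` (Taylor + 34g `borelTransform_unique`). [folklore] -/
theorem borelTransform_eq_of_taylor {B B' : ℂ → ℂ} {R K κ σ : ℝ} (hR : 0 < R) (hK : 0 < K) (hκ : 0 < κ) (hσ : 0 < σ)
    (hBd : DifferentiableOn ℂ B (ball 0 R ∪ {τ : ℂ | 0 < τ.re ∧ |τ.im| < κ * τ.re}))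
    (hB'd : DifferentiableOn ℂ B' (ball 0 K⁻¹ ∪ {τ : ℂ | 0 < τ.re ∧ |τ.im| < σ / 2 * τ.re}))
    (hB's : ∀ τ : ℂ, ‖τ‖ < K⁻¹ → HasSum (fun n : ℕ => iteratedDeriv n B 0 * (τ ^ n / (n ! : ℂ))) (B' τ)) :
    EqOn B' B (ball 0 (min R K⁻¹) ∪ {τ : ℂ | 0 < τ.re ∧ |τ.im| < min κ (σ / 2) * τ.re}) := by
  -- package the common domain as `ball 0 K₁⁻¹ ∪ T_{σ₁∕2}`
  set K₁ : ℝ := (min R K⁻¹)⁻¹ with hK₁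
  have hmin : 0 < min R K⁻¹ := lt_min hR (inv_pos.mpr hK)
  have hK₁pos : 0 < K₁ := inv_pos.mpr hmin
  have hK₁inv : K₁⁻¹ = min R K⁻¹ := by rw [hK₁, inv_inv]
  set σ₁ : ℝ := 2 * min κ (σ / 2) with hσ₁
  have hσ₁pos : 0 < σ₁ := by rw [hσ₁]; exact mul_pos two_pos (lt_min hκ (by positivity))
  have hσ₁h : σ₁ / 2 = min κ (σ / 2) := by rw [hσ₁]; ring
  have hsubT : ∀ μ : ℝ, min κ (σ / 2) ≤ μ →
      {τ : ℂ | 0 < τ.re ∧ |τ.im| < min κ (σ / 2) * τ.re} ⊆ {τ : ℂ | 0 < τ.re ∧ |τ.im| < μ * τ.re} :=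
    fun μ hμ τ hτ => ⟨hτ.1, hτ.2.trans_le (mul_le_mul_of_nonneg_right hμ hτ.1.le)⟩
  have hD : ball (0 : ℂ) K₁⁻¹ ∪ {τ : ℂ | 0 < τ.re ∧ |τ.im| < σ₁ / 2 * τ.re} =
      ball 0 (min R K⁻¹) ∪ {τ : ℂ | 0 < τ.re ∧ |τ.im| < min κ (σ / 2) * τ.re} := by rw [hK₁inv, hσ₁h]
  have h1 : DifferentiableOn ℂ B' (ball (0 : ℂ) K₁⁻¹ ∪ {τ : ℂ | 0 < τ.re ∧ |τ.im| < σ₁ / 2 * τ.re}) := by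
    rw [hD]
    exact hB'd.mono (union_subset_union (ball_subset_ball (min_le_right _ _)) (hsubT _ (min_le_right _ _)))
  have h2 : DifferentiableOn ℂ B (ball (0 : ℂ) K₁⁻¹ ∪ {τ : ℂ | 0 < τ.re ∧ |τ.im| < σ₁ / 2 * τ.re}) := by
    rw [hD]
    exact hBd.mono (union_subset_union (ball_subset_ball (min_le_left _ _)) (hsubT _ (min_le_left _ _)))
  have hs1 : ∀ τ : ℂ, ‖τ‖ < K₁⁻¹ → HasSum (fun n : ℕ => iteratedDeriv n B 0 * (τ ^ n / (n ! : ℂ))) (B' τ) :=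
    fun τ hτ => hB's τ (hτ.trans_le (by rw [hK₁inv]; exact min_le_right _ _))
  have hs2 : ∀ τ : ℂ, ‖τ‖ < K₁⁻¹ → HasSum (fun n : ℕ => iteratedDeriv n B 0 * (τ ^ n / (n ! : ℂ))) (B τ) :=
    fun τ hτ => hasSum_taylor_letters (hBd.mono subset_union_left) (hτ.trans_le (by rw [hK₁inv]; exact min_le_left _ _))
  have h := borelTransform_unique hK₁pos hσ₁pos h1 h2 hs1 hs2
  rwa [hD] at h

end

end Summit.QuantumFields.BalabanUV.Beta.EriceFlowEnclosureBorelCorrespondence
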